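import Mathlib

/-!
# The golden rule of the tilt law (kernel #222, paper §24.113, lemmaR-A5 §24)

Solo-blind programme, session s89.  In the `r`-variables of the leaf-aligned chain
(even class, tilt `κ → 0⁺`) the fast roll chain is `ṙ_m = -i h P (A_m r_{m-1} + B_m r_{m+1})`
with, at the true problem, `A_m = (m-2)/(m-1)` and `B_m = (m+2)/(m+1)`; in particular `A_2 = 0`
(the `m = 1` roll is an embedded neutral state of the continuum `m ≥ 2`) and `B_1 = 3/2`.
The cross-leaf tilt `x = κ g ≥ 0` opens the entry `r_1 → r_2` with weight
`A_2(x) = χ_{2,1} - c_2 d_1 = (2+x)/√((1+x)(4+x)) - (2/√(4+x))(1/√(1+x)) = x/√((1+x)(4+x))`,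
and the slow Floquet rate becomes, by a Schur complement and limiting absorption,
`α_1 = -K_0 - B_1 γ A_2 |h| P` with `γ = |G_22(0 ± i0)| = 4/3`, so `B_1 γ = 2`
(measured: detune slope `+.83 K_0 P T`, tilt slope `-.446 K_0 P T`; predicted `.8323`, `-.4478`).

This file proves the ALGEBRA of that statement:

* §A the tilt opening: the identity for `A_2(x)`, its positivity, the two-sided first-order bound
  `x/(x + 5/2) ≤ A_2(x) ≤ x/2`, `A_2 < 1`, and monotonicity of `A_2²`;
* §B Arnold's form: the weights `w_m = (m²-1)/3` satisfy the detailed balance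
  `w_m A_m = w_{m-1} B_{m-1}` (so `Σ w_m |r_m|²` is conserved by the fast chain for every `h`),
  the first-bond weight is `w_1 = 2δ/3` (definite iff the leg is de-rated, `δ > 0`), and the
  bond-flux identity that makes a detailed-balanced bond conservative;
* §C the golden-rule value: the zero-energy continued fraction of the `m ≥ 2` chain telescopes,
  `Q_{2n} = (4n²-1)/(3n²)`, `Q_{2n+1} = (2n+1)²/(3n(n+1))`, with exact defects `1/(3n²)` below and
  `1/(3n(n+1))` above `4/3`; `B_1 γ = (3/2)(4/3) = 2`; the scalar self-energy identity and the
  resulting real rate `-B γ δ |h| P` on the viscosity-selected branch.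
-/

namespace Summit.AnomalousDissipation.AnomalousDissipation.Theorems

open Finset

/-! ## §A  The tilt opening `A_2(x) = x / √((1+x)(4+x))` -/

/-- The tilt opening of the `r_1 → r_2` entry: `χ_{2,1} - c_2 d_1 = x/√((1+x)(4+x))`,
`x = κ g ≥ 0` (the numerators `(2 + x) - 2·1` leave exactly `x`). -/
theorem goldenRule_A2_eq (x : ℝ) (hx : 0 ≤ x) :
    (2 + x) / Real.sqrt ((1 + x) * (4 + x)) - (2 / Real.sqrt (4 + x)) * (1 / Real.sqrt (1 + x))
      = x / Real.sqrt ((1 + x) * (4 + x)) := by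
  have h1 : (0 : ℝ) ≤ 1 + x := by linarith
  have hs1 : 0 < Real.sqrt (1 + x) := Real.sqrt_pos.mpr (by linarith)
  have hs4 : 0 < Real.sqrt (4 + x) := Real.sqrt_pos.mpr (by linarith)
  rw [Real.sqrt_mul h1 (4 + x)]
  field_simp
  ring

/-- The opening is positive for every positive tilt. -/
theorem goldenRule_A2_pos (x : ℝ) (hx : 0 < x) :
    0 < x / Real.sqrt ((1 + x) * (4 + x)) :=
  div_pos hx (Real.sqrt_pos.mpr (by positivity))

/-- First-order upper bound: `A_2(x) ≤ x/2` (since `(1+x)(4+x) ≥ 4`), i.e. the tilt de-rates the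
first lift-up leg by at most `κ g / 2` — the coefficient that enters `∂_κ log μ = -P ∫ g |h|`. -/
theorem goldenRule_A2_le_half (x : ℝ) (hx : 0 ≤ x) :
    x / Real.sqrt ((1 + x) * (4 + x)) ≤ x / 2 := by
  have h2 : (2 : ℝ) ≤ Real.sqrt ((1 + x) * (4 + x)) := by
    have : Real.sqrt 4 = 2 := by
      rw [show (4 : ℝ) = 2 ^ 2 by norm_num, Real.sqrt_sq (by norm_num : (0:ℝ) ≤ 2)]
    rw [← this]
    exact Real.sqrt_le_sqrt (by nlinarith)
  exact div_le_div_of_nonneg_left hx (by norm_num) h2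

/-- First-order lower bound: `x/(x + 5/2) ≤ A_2(x)` (since `(1+x)(4+x) ≤ (x + 5/2)²`). -/
theorem goldenRule_A2_ge (x : ℝ) (hx : 0 ≤ x) :
    x / (x + 5 / 2) ≤ x / Real.sqrt ((1 + x) * (4 + x)) := by
  have hle : Real.sqrt ((1 + x) * (4 + x)) ≤ x + 5 / 2 := by
    calc Real.sqrt ((1 + x) * (4 + x)) ≤ Real.sqrt ((x + 5 / 2) ^ 2) :=
          Real.sqrt_le_sqrt (by nlinarith)
      _ = x + 5 / 2 := Real.sqrt_sq (by linarith)
  have hpos : 0 < Real.sqrt ((1 + x) * (4 + x)) := Real.sqrt_pos.mpr (by positivity)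
  exact div_le_div_of_nonneg_left hx hpos hle

/-- The squared opening `A_2² = x²/((1+x)(4+x))` is a proper fraction: `A_2 < 1` at every tilt. -/
theorem goldenRule_A2_sq_lt_one (x : ℝ) (hx : 0 ≤ x) :
    x ^ 2 / ((1 + x) * (4 + x)) < 1 := by
  rw [div_lt_one (by positivity)]
  nlinarith

/-- The squared opening is increasing in the tilt: more tilt, wider channel. -/
theorem goldenRule_A2_sq_mono (x y : ℝ) (hx : 0 ≤ x) (hxy : x ≤ y) :
    x ^ 2 / ((1 + x) * (4 + x)) ≤ y ^ 2 / ((1 + y) * (4 + y)) := by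
  have hy : 0 ≤ y := le_trans hx hxy
  rw [div_le_div_iff₀ (by positivity) (by positivity)]
  have h1 : 0 ≤ y - x := by linarith
  have h2 : 0 ≤ 5 * x * y + 4 * (x + y) := by positivity
  nlinarith [mul_nonneg h1 h2, mul_nonneg hx hy]

/-! ## §B  Arnold's form: the weights `(m² - 1)/3` and detailed balance -/

/-- Sub-diagonal hop of the fast roll chain at the true problem: into `r_m` from `r_{m-1}`. -/
noncomputable def grA (m : ℝ) : ℝ := (m - 2) / (m - 1)

/-- Super-diagonal hop: into `r_m` from `r_{m+1}`. -/
noncomputable def grB (m : ℝ) : ℝ := (m + 2) / (m + 1)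

/-- Arnold (energy–enstrophy) weight of the sinusoidal profile, normalised to `w_2 = 1`. -/
noncomputable def grW (m : ℝ) : ℝ := (m ^ 2 - 1) / 3

/-- `A_2 = 0`: the `m = 1` roll feeds nothing into the fast chain (embedded neutral mode). -/
theorem grA_two : grA 2 = 0 := by norm_num [grA]

/-- `B_1 = 3/2`: the back-coupling of `r_2` into `r_1` is of order one. -/
theorem grB_one : grB 1 = 3 / 2 := by norm_num [grB]

/-- Normalisation `w_2 = 1` and the blind spot `w_1 = 0` of Arnold's form at the true problem. -/
theorem grW_two : grW 2 = 1 := by norm_num [grW]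

/-- The blind spot: Arnold's form of the sinusoidal profile gives the `m = 1` roll weight zero. -/
theorem grW_one : grW 1 = 0 := by norm_num [grW]

/-- Squared Jacobi entries `b_m² = A_m B_{m-1} = (m-2)(m+1)/(m(m-1))`. -/
theorem grA_mul_grB_pred (m : ℝ) (h0 : m ≠ 0) (h1 : m ≠ 1) :
    grA m * grB (m - 1) = (m - 2) * (m + 1) / (m * (m - 1)) := by
  unfold grA grB
  have h1' : m - 1 ≠ 0 := sub_ne_zero.mpr h1
  have h0' : m - 1 + 1 ≠ 0 := by rwa [sub_add_cancel]
  field_simp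
  ring

/-- DETAILED BALANCE: `w_m A_m = w_{m-1} B_{m-1}` for the Arnold weights (all real `m ≠ 0, 1`;
used for `m ≥ 3`).  Consequently `diag(w) T` is symmetric and `Σ_m w_m |r_m|²` is conserved by
`ṙ = -i h(t) P T r` for every real clock `h(t)` (see `goldenRule_bond_flux`). -/
theorem arnold_detailed_balance (m : ℝ) (h0 : m ≠ 0) (h1 : m ≠ 1) :
    grW m * grA m = grW (m - 1) * grB (m - 1) := by
  unfold grW grA grB
  have h1' : m - 1 ≠ 0 := sub_ne_zero.mpr h1
  have h0' : m - 1 + 1 ≠ 0 := by rwa [sub_add_cancel]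
  field_simp
  ring

/-- The Arnold weights are positive on the continuum `m ≥ 2`. -/
theorem grW_pos (m : ℝ) (hm : 2 ≤ m) : 0 < grW m := by
  unfold grW
  have : 1 < m ^ 2 := by nlinarith
  linarith [div_pos (by linarith : (0:ℝ) < m ^ 2 - 1) (by norm_num : (0:ℝ) < 3)]

/-- FIRST BOND.  With the `r_1 → r_2` entry opened to `δ` (de-rated leg `θ_1 = 1 - δ`, or the
tilt `δ = A_2(κ g)`), detailed balance on the first bond `w_2 δ = w_1 B_1` with `w_2 = 1`,
`B_1 = 3/2` forces `w_1 = 2δ/3`. -/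
theorem arnold_first_bond (δ w₁ : ℝ) (h : grW 2 * δ = w₁ * grB 1) : w₁ = 2 * δ / 3 := by
  rw [grW_two, grB_one] at h
  linarith

/-- DEFINITENESS CRITERION: Arnold's form sees `r_1` with a positive weight iff the leg is
de-rated (`δ > 0`: every positive tilt); it is degenerate exactly at the true problem (`δ = 0`)
and indefinite for an over-rated leg (`δ < 0`, where the chain is observed unstable). -/
theorem arnold_definite_iff (δ : ℝ) : 0 < 2 * δ / 3 ↔ 0 < δ := by
  constructor <;> intro h <;> linarith

/-- Over-rated leg (`δ < 0`): the first weight is negative and the form is indefinite. -/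
theorem arnold_indefinite_iff (δ : ℝ) : 2 * δ / 3 < 0 ↔ δ < 0 := by
  constructor <;> intro h <;> linarith

/-- BOND-FLUX IDENTITY.  On one bond `u = r_{m-1}`, `v = r_m` of `ṙ = -i h P T r` the hop into `v`
is `-i h a u` (`a = P A_m`) and the hop into `u` is `-i h b v` (`b = P B_{m-1}`).  If the weights
are detailed-balanced, `w_v a = w_u b`, the bond's contribution to `d/dt (w_u |u|² + w_v |v|²)`,
namely `w_v · 2 Re(conj v · (-i h a u)) + w_u · 2 Re(conj u · (-i h b v))`, vanishes — for every
real `h`.  Summing over bonds: `Σ w_m |r_m|²` is conserved by the fast chain with any clock `h(t)`. -/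
theorem goldenRule_bond_flux (u v : ℂ) (h a b wu wv : ℝ) (hab : wv * a = wu * b) :
    wv * (2 * ((starRingEnd ℂ) v * (-(Complex.I * h * a) * u)).re)
      + wu * (2 * ((starRingEnd ℂ) u * (-(Complex.I * h * b) * v)).re) = 0 := by
  simp only [Complex.mul_re, Complex.mul_im, Complex.neg_re, Complex.neg_im, Complex.conj_re,
    Complex.conj_im, Complex.I_re, Complex.I_im, Complex.ofReal_re, Complex.ofReal_im]
  linear_combination (2 * h * (v.re * u.im - v.im * u.re)) * hab

/-! ## §C  The golden-rule value `γ = 4/3` and the rate -/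

/-- Squared off-diagonal entry of the symmetrised `m ≥ 2` chain, as a function of a rational
site label: `b²(m) = (m-2)/(m-1) · (m+1)/m`. -/
def bsq (m : ℚ) : ℚ := (m - 2) / (m - 1) * ((m + 1) / m)

/-- EVEN TRUNCATIONS of the zero-energy continued fraction `|G_22(0)| = lim Q_N`,
`Q_{2n} = ∏_{j=2}^{n} b²(2j) / b²(2j-1) = (4n² - 1)/(3n²)`. -/
theorem goldenRule_Q_even (n : ℕ) (hn : 1 ≤ n) :
    ∏ j ∈ Icc 2 n, bsq (2 * (j : ℚ)) / bsq (2 * (j : ℚ) - 1)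
      = (4 * (n : ℚ) ^ 2 - 1) / (3 * (n : ℚ) ^ 2) := by
  induction n, hn using Nat.le_induction with
  | base => norm_num
  | succ k hk ih =>
    rw [Finset.prod_Icc_succ_top (by omega : 2 ≤ k + 1), ih]
    unfold bsq
    have hk1 : (1 : ℚ) ≤ k := by exact_mod_cast hk
    push_cast
    have d1 : (k : ℚ) ≠ 0 := by positivity
    have d2 : (k : ℚ) + 1 ≠ 0 := by positivity
    have d3 : 2 * ((k : ℚ) + 1) - 1 ≠ 0 := by intro h; linarith
    have d4 : 2 * ((k : ℚ) + 1) - 2 ≠ 0 := by intro h; linarith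
    have d5 : 2 * ((k : ℚ) + 1) - 1 - 1 ≠ 0 := by intro h; linarith
    have d6 : 2 * ((k : ℚ) + 1) - 1 - 2 ≠ 0 := by intro h; linarith
    have d7 : 2 * ((k : ℚ) + 1) ≠ 0 := by positivity
    have d8 : 2 * ((k : ℚ) + 1) - 1 + 1 ≠ 0 := by intro h; linarith
    field_simp
    ring

/-- ODD TRUNCATIONS: `Q_{2n+1} = Q_{2n} / b²(2n+1) = (2n+1)²/(3n(n+1))`. -/
theorem goldenRule_Q_odd (n : ℕ) (hn : 1 ≤ n) :
    (∏ j ∈ Icc 2 n, bsq (2 * (j : ℚ)) / bsq (2 * (j : ℚ) - 1)) / bsq (2 * (n : ℚ) + 1)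
      = (2 * (n : ℚ) + 1) ^ 2 / (3 * ((n : ℚ) * ((n : ℚ) + 1))) := by
  rw [goldenRule_Q_even n hn]
  have hn1 : (1 : ℚ) ≤ n := by exact_mod_cast hn
  have hb : bsq (2 * (n : ℚ) + 1) = (2 * n - 1) / (2 * n) * ((2 * n + 2) / (2 * n + 1)) := by
    unfold bsq
    rw [show (2 * (n : ℚ) + 1 - 2) = 2 * n - 1 by ring, show (2 * (n : ℚ) + 1 - 1) = 2 * n by ring,
      show (2 * (n : ℚ) + 1 + 1) = 2 * n + 2 by ring]
  rw [hb]
  have d1 : (n : ℚ) ≠ 0 := by positivity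
  have d2 : (n : ℚ) + 1 ≠ 0 := by positivity
  have d3 : 2 * (n : ℚ) - 1 ≠ 0 := by intro h; linarith
  have d4 : 2 * (n : ℚ) ≠ 0 := by positivity
  have d5 : 2 * (n : ℚ) + 1 ≠ 0 := by positivity
  have d6 : 2 * (n : ℚ) + 2 ≠ 0 := by positivity
  have hc : (2 * (n : ℚ) - 1)⁻¹ * (2 * n - 1) = 1 := inv_mul_cancel₀ d3
  field_simp
  linear_combination (2 * (n : ℚ) + 1) * hc

/-- Exact defects: the even truncations sit `1/(3n²)` BELOW `4/3` … -/
theorem goldenRule_Q_even_defect (n : ℚ) (hn : n ≠ 0) :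
    4 / 3 - (4 * n ^ 2 - 1) / (3 * n ^ 2) = 1 / (3 * n ^ 2) := by
  field_simp
  ring

/-- … and the odd truncations `1/(3n(n+1))` ABOVE it; hence `γ = |G_22(0 ± i0)| = 4/3`. -/
theorem goldenRule_Q_odd_defect (n : ℚ) (hn : n ≠ 0) (hn1 : n + 1 ≠ 0) :
    (2 * n + 1) ^ 2 / (3 * (n * (n + 1))) - 4 / 3 = 1 / (3 * (n * (n + 1))) := by
  field_simp
  ring

/-- The bracket `Q_{2n} < 4/3 < Q_{2n+1}` for `n ≥ 1`. -/
theorem goldenRule_Q_bracket (n : ℚ) (hn : 1 ≤ n) :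
    (4 * n ^ 2 - 1) / (3 * n ^ 2) < 4 / 3 ∧ 4 / 3 < (2 * n + 1) ^ 2 / (3 * (n * (n + 1))) := by
  constructor
  · rw [div_lt_div_iff₀ (by positivity) (by norm_num)]
    nlinarith
  · rw [div_lt_div_iff₀ (by norm_num) (by positivity)]
    nlinarith

/-- The golden-rule coefficient: `B_1 γ = (3/2)(4/3) = 2`, i.e. `α_1 = -K_0 - 2 δ |h| P`. -/
theorem goldenRule_coefficient : grB 1 * (4 / 3 : ℝ) = 2 := by
  rw [grB_one]; norm_num

/-- SELF-ENERGY IDENTITY (Schur complement of the bordered chain): if the retained amplitude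
obeys `λ r_1 = c B r_2` and the eliminated block returns `r_2 = c δ G r_1` (injection `c δ`,
resolvent element `G`), then for `r_1 ≠ 0` the slow eigenvalue is `λ = c² B δ G`. -/
theorem goldenRule_selfEnergy (lam c B δ G r₁ r₂ : ℂ) (h1 : lam * r₁ = c * B * r₂)
    (h2 : r₂ = c * δ * G * r₁) (hr : r₁ ≠ 0) : lam = c ^ 2 * B * δ * G := by
  rw [h2] at h1
  have : (lam - c ^ 2 * B * δ * G) * r₁ = 0 := by linear_combination h1
  rcases mul_eq_zero.mp this with h | h
  · exact sub_eq_zero.mp h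
  · exact absurd h hr

/-- THE RATE.  In dimensionless form `λ = -i h P z`, `z = B δ G_22`, and on the branch selected by
viscosity `G_22 = -i γ s` with `s h = |h|` (`s = sign h`): the slow rate is REAL and equals
`-B γ δ |h| P` — damping for a de-rated leg (`δ > 0`), growth for an over-rated one, either sign
of the clock `h`. -/
theorem goldenRule_rate (h P B γ δ s : ℝ) (hs : s * h = |h|) :
    (-(Complex.I * h * P) * ((B * δ : ℝ) * (-(Complex.I * γ * s)))).re = -(B * γ * δ * |h| * P)
    ∧ (-(Complex.I * h * P) * ((B * δ : ℝ) * (-(Complex.I * γ * s)))).im = 0 := by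
  constructor
  · simp only [Complex.mul_re, Complex.mul_im, Complex.neg_re, Complex.neg_im, Complex.I_re,
      Complex.I_im, Complex.ofReal_re, Complex.ofReal_im, Complex.ofReal_mul]
    rw [← hs]; ring
  · simp only [Complex.mul_re, Complex.mul_im, Complex.neg_re, Complex.neg_im, Complex.I_re,
      Complex.I_im, Complex.ofReal_re, Complex.ofReal_im, Complex.ofReal_mul]
    ring

/-- Sign of the rate: strictly negative (damping) iff the leg is de-rated, given `h ≠ 0`,
`B γ > 0`, `P > 0`. -/
theorem goldenRule_rate_neg_iff (h P B γ δ : ℝ) (hh : h ≠ 0) (hB : 0 < B * γ) (hP : 0 < P) :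
    -(B * γ * δ * |h| * P) < 0 ↔ 0 < δ := by
  have ha : 0 < |h| := abs_pos.mpr hh
  have hc : 0 < B * γ * |h| * P := by positivity
  constructor
  · intro hlt
    by_contra hle
    have hle : δ ≤ 0 := not_lt.mp hle
    have : B * γ * δ * |h| * P ≤ 0 := by
      have : B * γ * δ * |h| * P = δ * (B * γ * |h| * P) := by ring
      rw [this]; exact mul_nonpos_of_nonpos_of_nonneg hle hc.le
    linarith
  · intro hδ
    have : 0 < B * γ * δ * |h| * P := by positivity
    linarith

end Summit.AnomalousDissipation.AnomalousDissipation.Theorems
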